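/-
Origin: expansion seat `planner-pub-hodgecm-mc-theta-3-g12-0`, handover (U3) 2026-08-20T04:33Z md5 e86a478a0917e74171ae693cfa4b79e5 (172 l.; NEW additive leaf over installed (U2) `HodgeCM.Model.ArchLineOrientBit` + (T) `HodgeCM.Model.ArchLineDatumTotal` (this kit, install first) + carch-1 #CA16 `HodgeCM.Model.ArchKTypeOfOrient` 39f8c1ecf444 (install first); the `𝔄` slot read through ι₁: place-bit/ι₁-bit bridge, `archLineDatumOfOrientBitι … (hc : SignRecipe.GoodCtx (orientBitι L ι₁) ι₁ c) (heq : (InfinitePlace.mk ι₁).embedding = ι₁)`, (T) read-offs in both branches; 12 theorems + 1 def; rc 0 / 0 warn / trio 13/13; drops WITH (T) or #CA16; NAME LIST: HodgeCM.Model.ArchSideTerm.orientBit_eq_orientBitι_of_embedding_eq · HodgeCM.Model.ArchSideTerm.not_hpos_of_goodCtx_orientBitι_of_embedding_ne · HodgeCM.Model.ArchSideTerm.archLineDatumTotal_Φinf_of_goodCtx_orientBitι) (`HOME/mc/pub-hodgecm-mc-theta-3-g12/lean/stage41/HodgeCM/Model/ArchLineOrientIota.lean`, md5 e86a478a0917,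 172 lines);
landed by the gen-15 packager (p-g15) in gate run 41 as `HodgeCM/Model/ArchLineOrientIota.lean` (verbatim).
-/
/-
Origin: speedrun cell pub-hodgecm, MODEL-CONSTRUCTION sub-cell, lineage mc-theta-3 (BINDER-OWNERS row 5, the `𝔄` slot),
seat planner-pub-hodgecm-mc-theta-3-g12-0 (gen 12), 2026-08-20.  Target in PKG: `HodgeCM/Model/ArchLineOrientIota.lean`
(NEW additive junction leaf over theta-3 (U2) `Model.ArchLineOrientBit` (RUN 40) + (T) `Model.ArchLineDatumTotal` (RUN 41)
and carch-1 #CA16 `Model.ArchKTypeOfOrient` (RUN 41): the `𝔄` slot READ THROUGH `ι₁`).  KERNEL only: 0 records / named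
facts / proof holes.  Ruling of record (ORIENT-h) (STATUS l.12517 (R2) / l.12532 (S1)): bit of record `orientBitι` (#CA16).
-/
import Summits.HodgeConjecture.HodgeCM.Model.ArchLineOrientBit
import Summits.HodgeConjecture.HodgeCM.Model.ArchLineDatumTotal_2
import Summits.HodgeConjecture.HodgeCM.Model.ArchKTypeOfOrient

/-!
# The `𝔄` slot read through `ι₁`: the place-bit / `ι₁`-bit bridge and the line datum in both branches

The bit of record of the oriented recipe (o) is carch-1's `orientBitι L ι₁ = decide (im (ι₁ δ_L) < 0)` (#CA16); theta-3's
(U2) `orientBit L ι₁` reads the same sign through the place representative `ρ = (mk ι₁).embedding`.  This leaf records,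
with NO new definition:

* the bridge: `orientBit L ι₁ = orientBitι L ρ` (rfl: the place-bit IS the `ι₁`-bit of the representative);
  ID BRANCH `ρ = ι₁`: `orientBit L ι₁ = orientBitι L ι₁`; CONJ BRANCH `ρ ≠ ι₁`: `orientBit L ι₁ = ! orientBitι L ι₁`;
* (F2)'s orientation Prop `hor` for the bit of record: it HOLDS in the id branch (`orient_orientBitι_of_embedding_eq`) and
  holds for the NEGATED bit in the conj branch (`orient_not_orientBitι_of_embedding_ne`);
* hence at a good context of the bit of record, `SignRecipe.GoodCtx (orientBitι L ι₁) ι₁ c`: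
  ID BRANCH — all four context lines are model-positive at `v₁`, (F2)'s positive line datum is available with `hor`
  DISCHARGED (`archLineDatumOfOrientBitι … hc heq`, rfl to (F1) `archLineDatumOf`), and theta-3's TOTAL datum (T) READS
  exactly those degree-one vectors there (`archLineDatumTotal_Φinf_of_goodCtx_orientBitι`);
  CONJ BRANCH — all four lines are model-NEGATIVE at `v₁` (`not_hpos_of_goodCtx_orientBitι_of_embedding_ne`) and (T) reads
  the vacuum of each line (`archLineDatumTotal_Φinf_of_goodCtx_orientBitι_of_embedding_ne`) — the (TWIST-2) residual on the
  `𝔄` side, route (m) of record (STATUS l.12532 (S4)): this is the branch the mirror z̄-type vectors will fill.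
-/

set_option autoImplicit false

noncomputable section

open NumberField NumberField.InfinitePlace NumberField.mixedEmbedding IsDedekindDomain
open scoped Matrix Kronecker Classical TensorProduct ComplexConjugate SchwartzMap
open MvPolynomial
open Literature.NumberTheory.Automorphic Literature.NumberTheory.Automorphic.UnitaryGroup Literature.NumberTheory.Weil1964
open Literature.RepresentationTheory.KonnoKonno2007 Literature.RepresentationTheory.KonnoKonno2007.RealDualPair
open Literature.NumberTheory.GelbartRogawski1991 Literature.NumberTheory.GelbartRogawski1991.UnitaryDualPair
open Literature.Analysis.SegalBargmann
open HodgeCM.Adelic HodgeCM.PerL34 HodgeCM.Model.HypCensus HodgeCM.Model.SupplyInstance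

namespace HodgeCM.Model.ArchSideTerm

/-! ## 1. The bridge between the place-bit (U2) and the `ι₁`-bit of record (#CA16) -/

section Bridge

variable (L : CMField) (ι₁ : L →+* ℂ)

/-- the place-bit IS the `ι₁`-bit of the place representative (definitional). -/
theorem orientBit_eq_orientBitι_embedding : orientBit L ι₁ = orientBitι L (InfinitePlace.mk ι₁).embedding := rfl

/-- **ID BRANCH: the place-bit is the bit of record.** -/
theorem orientBit_eq_orientBitι_of_embedding_eq (heq : (InfinitePlace.mk ι₁).embedding = ι₁) :
    orientBit L ι₁ = orientBitι L ι₁ := by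
  rw [orientBit_eq_orientBitι_embedding, heq]

/-- **CONJ BRANCH: the place-bit is the NEGATION of the bit of record.** -/
theorem orientBit_eq_not_orientBitι_of_embedding_ne (hne : (InfinitePlace.mk ι₁).embedding ≠ ι₁) :
    orientBit L ι₁ = !orientBitι L ι₁ := by
  rw [orientBit_eq_orientBitι_embedding, UnitaryGroup.embedding_mk_eq_conjugate_of_ne (L : Type) ι₁ hne, orientBitι_conjugate]

/-- **ID BRANCH: (F2)'s orientation Prop HOLDS for the bit of record.** -/
theorem orient_orientBitι_of_embedding_eq (heq : (InfinitePlace.mk ι₁).embedding = ι₁) :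
    0 < ((InfinitePlace.mk ι₁).embedding (imagUnit (L : Type))).im ↔ orientBitι L ι₁ = false := by
  rw [← orientBit_eq_orientBitι_of_embedding_eq L ι₁ heq]
  exact orientBit_spec L ι₁

/-- **CONJ BRANCH: (F2)'s orientation Prop holds for the NEGATED bit of record** (so it FAILS for the bit of record). -/
theorem orient_not_orientBitι_of_embedding_ne (hne : (InfinitePlace.mk ι₁).embedding ≠ ι₁) :
    0 < ((InfinitePlace.mk ι₁).embedding (imagUnit (L : Type))).im ↔ (!orientBitι L ι₁) = false := by
  rw [← orientBit_eq_not_orientBitι_of_embedding_ne L ι₁ hne]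
  exact orientBit_spec L ι₁

/-- (Ported verbatim from the HodgeCMPerL package; no docstring in the source.) -/
theorem not_orient_orientBitι_of_embedding_ne (hne : (InfinitePlace.mk ι₁).embedding ≠ ι₁) :
    ¬ (0 < ((InfinitePlace.mk ι₁).embedding (imagUnit (L : Type))).im ↔ orientBitι L ι₁ = false) := fun h => by
  have h2 := orient_not_orientBitι_of_embedding_ne L ι₁ hne
  rw [h] at h2
  cases hb : orientBitι L ι₁ <;> simp [hb] at h2

end Bridge

/-! ## 2. Slot signs at a good context of the bit of record -/

section Slots

variable {L : CMField} {ι₁ : L →+* ℂ} (V : HermSpace3 L ι₁) {c : SeesawCtx L}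

/-- **ID BRANCH: every context line of a good context of the bit of record is model-positive at `v₁`.** -/
theorem hpos_of_goodCtx_orientBitι_of_embedding_eq (hc : SignRecipe.GoodCtx (orientBitι L ι₁) ι₁ c)
    (heq : (InfinitePlace.mk ι₁).embedding = ι₁) (i : Fin 4) (hd : IsCMField.complexConj L (c.D.a i) = c.D.a i) :
    0 < cmXW (L : Type) (frameD V) (lineVec (L : Type) (c.D.a i)) (fun _ => hd) ι₁ (HypCensus.cmPlace (L : Type) ι₁) 0 :=
  (hpos_iff_eq_orientBitι_of_goodCtx_of_embedding_eq V heq hc i hd).2 rfl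

/-- **CONJ BRANCH: every context line of a good context of the bit of record is model-NEGATIVE at `v₁`** ((TWIST-2), `𝔄` side). -/
theorem not_hpos_of_goodCtx_orientBitι_of_embedding_ne (hc : SignRecipe.GoodCtx (orientBitι L ι₁) ι₁ c)
    (hne : (InfinitePlace.mk ι₁).embedding ≠ ι₁) (i : Fin 4) (hd : IsCMField.complexConj L (c.D.a i) = c.D.a i) :
    ¬ 0 < cmXW (L : Type) (frameD V) (lineVec (L : Type) (c.D.a i)) (fun _ => hd) ι₁ (HypCensus.cmPlace (L : Type) ι₁) 0 := by
  rw [hpos_iff_eq_not_orientBitι_of_goodCtx_of_embedding_ne V hne hc i hd]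
  cases orientBitι L ι₁ <;> decide

/-- conj branch, the OTHER bit: a good context of `! orientBitι` has all four lines model-positive (the literal slot). -/
theorem hpos_of_goodCtx_not_orientBitι_of_embedding_ne (hc : SignRecipe.GoodCtx (!orientBitι L ι₁) ι₁ c)
    (hne : (InfinitePlace.mk ι₁).embedding ≠ ι₁) (i : Fin 4) (hd : IsCMField.complexConj L (c.D.a i) = c.D.a i) :
    0 < cmXW (L : Type) (frameD V) (lineVec (L : Type) (c.D.a i)) (fun _ => hd) ι₁ (HypCensus.cmPlace (L : Type) ι₁) 0 :=
  (hpos_iff_eq_not_orientBitι_of_goodCtx_of_embedding_ne V hne hc i hd).2 rfl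

end Slots

/-! ## 3. The line datum at a good context of the bit of record -/

section Datum

variable {L : CMField} {ι₁ : L →+* ℂ} (V : HermSpace3 L ι₁) (c : SeesawCtx L)
variable
  (hGR : (cmSplittingDatum (L : Type) finProdFinEquiv (frameD V) (frameD_real V) (frameD_ne V) (dW c.D) (dW_real c.D)
    (dW_ne c.D)).CompatibleSplitting)
  (hGR₀ : (cmSplittingDatum (L : Type) (e₁) (frameD V) (frameD_real V) (frameD_ne V) (lineVec (L : Type) (dW c.D 0))
    (fun _ => dW_real c.D 0) (fun _ => dW_ne c.D 0)).CompatibleSplitting)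
  (hGR₁ : (cmSplittingDatum (L : Type) (e₁) (frameD V) (frameD_real V) (frameD_ne V) (lineVec (L : Type) (dW c.D 1))
    (fun _ => dW_real c.D 1) (fun _ => dW_ne c.D 1)).CompatibleSplitting)
  (hGR₂ : (cmSplittingDatum (L : Type) (e₁) (frameD V) (frameD_real V) (frameD_ne V) (lineVec (L : Type) (dW' c.D 0))
    (fun _ => dW'_real c.D 0) (fun _ => dW'_ne c.D 0)).CompatibleSplitting)
  (hGR₃ : (cmSplittingDatum (L : Type) (e₁) (frameD V) (frameD_real V) (frameD_ne V) (lineVec (L : Type) (dW' c.D 1))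
    (fun _ => dW'_real c.D 1) (fun _ => dW'_ne c.D 1)).CompatibleSplitting)
  (η : CMAdelic (L : Type) (frameD V) × CMAdelic (L : Type) (dW c.D) →* ℂˣ)
  (μ : Fin 4 → (InfinitePlace (L : Type) → ℤ))

/-- **ID BRANCH: the positive archimedean line datum at a good context of the bit of record** — (F2)'s
`archLineDatumOfOrient` with `hor` DISCHARGED. -/
def archLineDatumOfOrientBitι (hc : SignRecipe.GoodCtx (orientBitι L ι₁) ι₁ c) (heq : (InfinitePlace.mk ι₁).embedding = ι₁) :=
  archLineDatumOfOrient V c hGR hGR₀ hGR₁ hGR₂ hGR₃ η μ hc (orient_orientBitι_of_embedding_eq L ι₁ heq)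

/-- read-back: it IS (F1)'s `archLineDatumOf` at the four discharged positivity conditions (definitional). -/
theorem archLineDatumOfOrientBitι_eq (hc : SignRecipe.GoodCtx (orientBitι L ι₁) ι₁ c)
    (heq : (InfinitePlace.mk ι₁).embedding = ι₁) (hμ₀ hμ₁ hμ₂ hμ₃) :
    archLineDatumOfOrientBitι V c hGR hGR₀ hGR₁ hGR₂ hGR₃ η μ hc heq hμ₀ hμ₁ hμ₂ hμ₃ =
      archLineDatumOf V c.D hGR hGR₀ hGR₁ hGR₂ hGR₃ η μ
        (hpos₀_of_orient V c hc (orient_orientBitι_of_embedding_eq L ι₁ heq))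
        (hpos₁_of_orient V c hc (orient_orientBitι_of_embedding_eq L ι₁ heq))
        (hpos₂_of_orient V c hc (orient_orientBitι_of_embedding_eq L ι₁ heq))
        (hpos₃_of_orient V c hc (orient_orientBitι_of_embedding_eq L ι₁ heq)) hμ₀ hμ₁ hμ₂ hμ₃ :=
  rfl

/-- **ID BRANCH: the TOTAL datum (T) reads the degree-one vectors at a good context of the bit of record.** -/
theorem archLineDatumTotal_Φinf_of_goodCtx_orientBitι (hc : SignRecipe.GoodCtx (orientBitι L ι₁) ι₁ c)
    (heq : (InfinitePlace.mk ι₁).embedding = ι₁) (hμ₀ hμ₁ hμ₂ hμ₃) :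
    (archLineDatumTotal V c.D hGR hGR₀ hGR₁ hGR₂ hGR₃ η μ hμ₀ hμ₁ hμ₂ hμ₃).Φinf =
      linePhiVec V c.D (hpos₀_of_orient V c hc (orient_orientBitι_of_embedding_eq L ι₁ heq))
        (hpos₁_of_orient V c hc (orient_orientBitι_of_embedding_eq L ι₁ heq))
        (hpos₂_of_orient V c hc (orient_orientBitι_of_embedding_eq L ι₁ heq))
        (hpos₃_of_orient V c hc (orient_orientBitι_of_embedding_eq L ι₁ heq)) :=
  archLineDatumTotal_Φinf_of_goodCtx V c hGR hGR₀ hGR₁ hGR₂ hGR₃ η μ hc (orient_orientBitι_of_embedding_eq L ι₁ heq) _ _ _ _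

/-- **CONJ BRANCH: the TOTAL datum (T) reads the VACUUM of every line at a good context of the bit of record**
(the branch the mirror z̄-type vectors of route (m) will fill). -/
theorem archLineDatumTotal_Φinf_of_goodCtx_orientBitι_of_embedding_ne (hc : SignRecipe.GoodCtx (orientBitι L ι₁) ι₁ c)
    (hne : (InfinitePlace.mk ι₁).embedding ≠ ι₁) (hμ₀ hμ₁ hμ₂ hμ₃) (k : Fin 4) :
    (archLineDatumTotal V c.D hGR hGR₀ hGR₁ hGR₂ hGR₃ η μ hμ₀ hμ₁ hμ₂ hμ₃).Φinf k =
      ![vacPhi V (dW c.D 0) (dW_real c.D 0) (dW_ne c.D 0), vacPhi V (dW c.D 1) (dW_real c.D 1) (dW_ne c.D 1),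
        vacPhi V (dW' c.D 0) (dW'_real c.D 0) (dW'_ne c.D 0), vacPhi V (dW' c.D 1) (dW'_real c.D 1) (dW'_ne c.D 1)] k :=
  archLineDatumTotal_Φinf_of_goodCtx_of_not_orient V c hGR hGR₀ hGR₁ hGR₂ hGR₃ η μ hc
    (not_orient_orientBitι_of_embedding_ne L ι₁ hne) _ _ _ _ k

end Datum

end HodgeCM.Model.ArchSideTerm

end
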